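import Mathlib
import HarnessLib
import Literature.AlgebraicGeometry.Resolution.BlowupsProperProofs
import Literature.AlgebraicGeometry.Resolution.AffineBlowupUniversal
import Literature.AlgebraicGeometry.Resolution.BlowupsLocal
import Literature.AlgebraicGeometry.Resolution.IdealSheafLemmas
import Literature.AlgebraicGeometry.Resolution.QuasiExcellentSchemes
import Literature.AlgebraicGeometry.Motives.ProjectiveDescentNormProofs
import Summits.ResolutionOfSingularities.ResolutionOfSingularities.Theorems.WildQuotientsWildQuotientResolutionPhaseZeroPClosed

/-!
# Mumford's hypothesis survives an equivariant blow-up (crux `WildQuotients.WildQuotientResolution`, line `Sketch`)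

Stub `stub_stableAffineCoverBlowup` of the skeleton `Sketch` for crux stmt-ResolutionOfSingularities-15640
(route `ResolutionOfSingularities/WildQuotients`, card `p-closure-sylow-separation`). Phase 0 of the
wild-quotient resolution replaces the regular `G`-scheme `X′` (AFFINE over `X₁` through the
`G`-invariant `q`) by a `G`-equivariant blow-up `π : X♯ → X′`; to form the quotient `X♯/G` as a
scheme one needs Mumford's hypothesis (*Abelian Varieties*, §7, Thm. p. 66): every point of `X♯` has
a `G`-STABLE AFFINE open neighbourhood. This file proves it for any blow-up carrying a compatible
action:

* `exists_iso_affineBlowup` — a blow-up (universal property, `IsBlowup`) of an AFFINE scheme `Y` is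
  isomorphic to the construction `Bl_{I₀}(Spec Γ(Y, 𝒪_Y)) = Proj` of the Rees algebra of the ideal
  `I₀` of global sections of the centre (`affineBlowup.isBlowup` + `IsBlowup.unique`, the transport
  of `exists_isBlowup_of_isAffine`);
* `exists_isAffineOpen_forall_mem_of_isBlowup` — hence every finite set of points of a blow-up of an
  affine scheme lies in an affine open: a basic open `D₊(F)` of `Proj`, `F` a form of positive degree
  through the finitely many points (graded prime avoidance,
  `Motives.GradedPrimeAvoidance.exists_form_basicOpen`; `Proj.isAffineOpen_basicOpen`);
* `stub_stableAffineCoverBlowup` — the stub: with `O ∋ π x` a `G`-stable affine open of `X′`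
  (`PClosedCase.exists_isAffineOpen_stable`, `q⁻¹` of an affine open of `X₁`), the orbit `G·x` lies
  in the blow-up `π⁻¹O → O` of the affine `O` (`IsBlowup.restrict`), hence in an affine open
  `U₀ ⊆ X♯`; the intersection `⋂_g (ρ♯ g)⁻¹ U₀` of its translates is `G`-stable, contains `x`, and
  is affine as a finite intersection of affine opens of the separated `X♯` (`IsAffineOpen.iInf`;
  `X♯` is separated since `π` is proper, `IsBlowup.isProper`, and `X′` is separated,
  `Scheme.isSeparated_of_isSeparated_over`) — the pattern of `Theorems.exists_stableAffineOpens_mem`.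
-/

-- single-problem summit: the doubled namespace component `ResolutionOfSingularities` is forced
set_option linter.dupNamespace false

noncomputable section

namespace Summit.ResolutionOfSingularities.ResolutionOfSingularities.Theorems.WildQuotientResolution.StableAffineCoverBlowup

open CategoryTheory AlgebraicGeometry TopologicalSpace
open Literature.AlgebraicGeometry.Resolution

universe u

/-! ## Blow-ups of affine schemes are `Proj` of a Rees algebra -/

/-- **A blow-up of an affine scheme is a `Proj`.** If `Y` is affine and `p : Y′ → Y` is a blow-up
of `Y` along the ideal sheaf `K` (universal property, Görtz–Wedhorn I, Def. 13.90), then `Y′` is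
isomorphic to the constructed blowing up `Bl_{I₀}(Spec Γ(Y, 𝒪_Y)) = Proj Γ(Y, 𝒪_Y)[I₀ t]` for an
ideal `I₀` of `Γ(Y, 𝒪_Y)` (namely the ideal of global sections of `K`): after `Y ≅ Spec Γ(Y, 𝒪_Y)`
the ideal sheaf `K` is `Ĩ₀` (`Scheme.IdealSheafData.ext_of_isAffine`), `Bl_{I₀} → Spec Γ(Y, 𝒪_Y) ≅ Y`
is a blow-up of `Y` along `K` (`affineBlowup.isBlowup`, `IsBlowup.comp_iso`), and two blow-ups along
the same ideal sheaf are isomorphic (`IsBlowup.unique`). [cite: GortzWedhorn2020, Prop. 13.92] -/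
theorem exists_iso_affineBlowup {Y Y' : Scheme.{u}} [IsAffine Y] {p : Y' ⟶ Y}
    {K : Y.IdealSheafData} (hp : IsBlowup p K) :
    ∃ I₀ : Ideal Γ(Y, ⊤), Nonempty (Y' ≅ affineBlowup I₀) := by
  -- adapted from `exists_isBlowup_of_isAffine` (AffineBlowupUniversal.lean)
  let e := Y.isoSpec
  let K' : (Spec Γ(Y, ⊤)).IdealSheafData := K.comap e.inv
  let J₀ : Ideal Γ(Spec Γ(Y, ⊤), ⊤) := K'.ideal ⟨⊤, isAffineOpen_top _⟩
  let I₀ : Ideal Γ(Y, ⊤) := J₀.comap (Scheme.ΓSpecIso Γ(Y, ⊤)).inv.hom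
  have hsurj : Function.Surjective (Scheme.ΓSpecIso Γ(Y, ⊤)).inv.hom :=
    (Scheme.ΓSpecIso Γ(Y, ⊤)).symm.commRingCatIsoToRingEquiv.surjective
  have hK' : Scheme.IdealSheafData.ofIdealTop J₀ = K' := by
    apply Scheme.IdealSheafData.ext_of_isAffine
    rw [ideal_ofIdealTop_top]
  have hK : affineBlowup.idealSheaf (R := Γ(Y, ⊤)) I₀ = K' := by
    rw [← hK', affineBlowup.idealSheaf]
    change Scheme.IdealSheafData.ofIdealTop ((J₀.comap (Scheme.ΓSpecIso Γ(Y, ⊤)).inv.hom).map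
      (Scheme.ΓSpecIso Γ(Y, ⊤)).inv.hom) = _
    rw [Ideal.map_comap_of_surjective _ hsurj]
  have h : IsBlowup (affineBlowup.π I₀) K' := hK ▸ affineBlowup.isBlowup I₀
  have h' := h.comp_iso e.symm
  have hJ : K'.comap e.symm.inv = K := by
    change (K.comap e.inv).comap e.hom = K
    rw [← Scheme.IdealSheafData.comap_comp, e.hom_inv_id, Scheme.IdealSheafData.comap_id]
  rw [hJ] at h'
  obtain ⟨e', -, -⟩ := hp.unique h'
  exact ⟨I₀, ⟨e'⟩⟩

/-- **Finitely many points of a blow-up of an affine scheme lie in an affine open** (the case of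
Mumford's remark "any finite set of points of a quasi-projective variety is contained in an open
affine subset", *Abelian Varieties* p. 69, needed here): `Y′ ≅ Proj A` for a Rees algebra `A`
(`exists_iso_affineBlowup`), and graded prime avoidance provides a form `F` of positive degree with
the given points in the affine basic open `D₊(F)` (`GradedPrimeAvoidance.exists_form_basicOpen`,
`Proj.isAffineOpen_basicOpen`). [cite: MumfordAV1970, §7, Remark p. 69] -/
theorem exists_isAffineOpen_forall_mem_of_isBlowup {Y Y' : Scheme.{u}} [IsAffine Y] {p : Y' ⟶ Y}
    {K : Y.IdealSheafData} (hp : IsBlowup p K) (S : Finset Y') :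
    ∃ U : Y'.Opens, IsAffineOpen U ∧ ∀ s ∈ S, s ∈ U := by
  classical
  obtain ⟨I₀, ⟨e⟩⟩ := exists_iso_affineBlowup hp
  obtain ⟨n, F, hn, hFn, hT, -⟩ :=
    Literature.AlgebraicGeometry.Motives.GradedPrimeAvoidance.exists_form_basicOpen
      (reesGrading I₀) e.hom e.hom.isClosedEmbedding.injective e.hom.isClosedEmbedding.isClosedMap
      S ⊤ (fun _ _ => trivial)
  exact ⟨e.hom ⁻¹ᵁ Proj.basicOpen (reesGrading I₀) F,
    (Proj.isAffineOpen_basicOpen (reesGrading I₀) F hFn hn).preimage_of_isIso e.hom, hT⟩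

/-! ## The stub -/

/-- **Mumford's hypothesis survives an equivariant blow-up.** Let the finite group `G` act on the
separated locally Noetherian `X′` over `X₁` through the AFFINE `q` (`ρ g ≫ q = q`), and let
`π : X♯ → X′` be a blow-up along an ideal sheaf `J` carrying an action `ρ♯` of `G` with `π`
equivariant. Then every point `x ∈ X♯` has a `G`-stable affine open neighbourhood. Proof: take a
`G`-stable affine open `O ∋ π x` of `X′` (`PClosedCase.exists_isAffineOpen_stable`); the orbit
`G·x` lies in `π⁻¹O`, a blow-up of the affine `O` (`IsBlowup.restrict`), hence in an affine open
`U₀` of `X♯` (`exists_isAffineOpen_forall_mem_of_isBlowup`); then `⋂_g (ρ♯ g)⁻¹ U₀` is `G`-stable,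
contains `x`, and is affine, `X♯` being separated (`π` is proper, `IsBlowup.isProper`, over the
separated `X′`; `Scheme.isSeparated_of_isSeparated_over`).
[cite: MumfordAV1970, §7 Thm. p. 66 (proof)] -/
theorem stub_stableAffineCoverBlowup {X' X₁ : Scheme.{0}} (q : X' ⟶ X₁) [IsAffineHom q]
    [X'.IsSeparated] [IsLocallyNoetherian X']
    {G : Type} [Group G] [Finite G] (ρ : G →* Aut X') (hρ : ∀ g : G, (ρ g).hom ≫ q = q)
    {Xs : Scheme.{0}} {π : Xs ⟶ X'} {J : X'.IdealSheafData} (hπ : IsBlowup π J)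
    (ρs : G →* Aut Xs) (hequiv : ∀ g : G, (ρs g).hom ≫ π = π ≫ (ρ g).hom) (x : Xs) :
    ∃ U : Xs.Opens, IsAffineOpen U ∧ x ∈ U ∧ ∀ g : G, (ρs g).hom ⁻¹ᵁ U = U := by
  classical
  let _ : Fintype G := Fintype.ofFinite G
  -- `X♯` is separated
  haveI : IsProper π := hπ.isProper
  haveI : Xs.IsSeparated := Scheme.isSeparated_of_isSeparated_over π
  -- (1) a `G`-stable affine open `O ∋ π x` of `X′`
  obtain ⟨O, hO, hxO, hOstab⟩ := PClosedCase.exists_isAffineOpen_stable q ρ hρ (π.base x)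
  -- (2) the orbit of `x` lies over `O`
  have hmemV : ∀ g : G, (ρs g).hom.base x ∈ π ⁻¹ᵁ O := by
    intro g
    change x ∈ (ρs g).hom ⁻¹ᵁ π ⁻¹ᵁ O
    rw [← Scheme.Hom.comp_preimage, hequiv g, Scheme.Hom.comp_preimage, hOstab g]
    exact hxO
  -- (3) an affine open of `X♯` containing the orbit
  haveI : IsAffine (O : Scheme.{0}) := hO
  have hπO : IsBlowup (π ∣_ O) (J.comap O.ι) := hπ.restrict O
  let S : Finset (π ⁻¹ᵁ O : Scheme.{0}) :=
    Finset.univ.image fun g : G => (⟨(ρs g).hom.base x, hmemV g⟩ : (π ⁻¹ᵁ O : Scheme.{0}))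
  obtain ⟨U₁, hU₁, hSU₁⟩ := exists_isAffineOpen_forall_mem_of_isBlowup hπO S
  let U₀ : Xs.Opens := (π ⁻¹ᵁ O).ι ''ᵁ U₁
  have hU₀ : IsAffineOpen U₀ := hU₁.image_of_isOpenImmersion _
  have hmem : ∀ g : G, (ρs g).hom.base x ∈ U₀ := by
    intro g
    refine ⟨⟨(ρs g).hom.base x, hmemV g⟩, hSU₁ _ ?_, rfl⟩
    exact Finset.mem_image_of_mem _ (Finset.mem_univ g)
  -- (4) the intersection of the translates of `U₀`
  let U : Xs.Opens := ⨅ g : G, (ρs g).hom ⁻¹ᵁ U₀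
  have hUcoe : ((U : Xs.Opens) : Set Xs) = ⋂ g : G, (ρs g).hom.base ⁻¹' (U₀ : Set Xs) := by
    change (((⨅ g : G, (ρs g).hom ⁻¹ᵁ U₀) : Xs.Opens) : Set Xs) = _
    rw [TopologicalSpace.Opens.coe_iInf]
    rfl
  -- `x ∈ U`
  have hxU : x ∈ U := by
    change x ∈ ((U : Xs.Opens) : Set Xs)
    rw [hUcoe]
    exact Set.mem_iInter.mpr fun g => hmem g
  -- `U` is `G`-stable
  have hstab : ∀ h : G, (ρs h).hom ⁻¹ᵁ U = U := by
    intro h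
    ext1
    rw [TopologicalSpace.Opens.map_coe, hUcoe, Set.preimage_iInter]
    have e : ∀ g : G, (ρs h).hom.base ⁻¹' ((ρs g).hom.base ⁻¹' (U₀ : Set Xs)) =
        (ρs (g * h)).hom.base ⁻¹' (U₀ : Set Xs) := by
      intro g
      rw [← Set.preimage_comp, map_mul, Aut.Aut_mul_def, Iso.trans_hom]
      rfl
    simp_rw [e]
    exact (Equiv.mulRight h).iInf_comp (g := fun g : G => (ρs g).hom.base ⁻¹' (U₀ : Set Xs))
  -- `U` is affine: a finite intersection of affine opens of the separated `X♯`
  have hUaff : IsAffineOpen U := IsAffineOpen.iInf fun g => hU₀.preimage (ρs g).hom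
  exact ⟨U, hUaff, hxU, hstab⟩

end Summit.ResolutionOfSingularities.ResolutionOfSingularities.Theorems.WildQuotientResolution.StableAffineCoverBlowup

end
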